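import Literature.Analysis.FluidPDE.FluidComputer.TubeTable
import HarnessLib

/-!
# Kernel run of the tube checker, chunks 24 … 29 (steps 1200 … 1499) (bp3 gen 13)

HONEST FRAMING: low prior, high value-of-information experiment on Tao's machine paradigm; NOT a
claim that NS blows up.

Kernel evaluations (`decide +kernel`; no `native_decide`, no extra axioms) of the tube checker
`runTube` of `TubeCheck.lean` (dyadic interval arithmetic `DI` at `P = 60`, `12` Taylor terms,
cube radius `Rt`, read-out level `CLt`) on the chunks `cT 24 … cT 29` of the schedule of
`TubeTable.lean`, each from the recorded boundary state `sT i` to `sT (i+1)` (≈ 0.6 s of kernel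
time per step).
-/

namespace Literature.Analysis.FluidPDE.FluidComputer

namespace TubeTable

open ThresholdLevelTable

set_option maxHeartbeats 10000000 in
set_option maxRecDepth 200000 in
/-- Chunk 24 of the tube run (steps 1200 … 1249, `h = 2^-11`). [folklore] -/
theorem run_24 : runTube 60 12 GIt CLt Rt (sT 24) (cT 24) = some (sT (24 + 1)) := by
  decide +kernel

set_option maxHeartbeats 10000000 in
set_option maxRecDepth 200000 in
/-- Chunk 25 of the tube run (steps 1250 … 1299, `h = 2^-11`). [folklore] -/
theorem run_25 : runTube 60 12 GIt CLt Rt (sT 25) (cT 25) = some (sT (25 + 1)) := by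
  decide +kernel

set_option maxHeartbeats 10000000 in
set_option maxRecDepth 200000 in
/-- Chunk 26 of the tube run (steps 1300 … 1349, `h = 2^-11`). [folklore] -/
theorem run_26 : runTube 60 12 GIt CLt Rt (sT 26) (cT 26) = some (sT (26 + 1)) := by
  decide +kernel

set_option maxHeartbeats 10000000 in
set_option maxRecDepth 200000 in
/-- Chunk 27 of the tube run (steps 1350 … 1399, `h = 2^-11`). [folklore] -/
theorem run_27 : runTube 60 12 GIt CLt Rt (sT 27) (cT 27) = some (sT (27 + 1)) := by
  decide +kernel

set_option maxHeartbeats 10000000 in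
set_option maxRecDepth 200000 in
/-- Chunk 28 of the tube run (steps 1400 … 1449, `h = 2^-11`). [folklore] -/
theorem run_28 : runTube 60 12 GIt CLt Rt (sT 28) (cT 28) = some (sT (28 + 1)) := by
  decide +kernel

set_option maxHeartbeats 10000000 in
set_option maxRecDepth 200000 in
/-- Chunk 29 of the tube run (steps 1450 … 1499, `h = 2^-11`). [folklore] -/
theorem run_29 : runTube 60 12 GIt CLt Rt (sT 29) (cT 29) = some (sT (29 + 1)) := by
  decide +kernel

end TubeTable

end Literature.Analysis.FluidPDE.FluidComputer
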